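import Summits.PneNP.PneNP.Theorems.SzkEntropyPeaWorstToAvgReductions
import Summits.PneNP.PneNP.Theorems.SzkEntropyPeaWorstToAvgDualModeCard
import Summits.PneNP.PneNP.Theorems.PeaWorstToAvg.Negative.PeaWorstToAvgStrengthenings
import Summits.PneNP.PneNP.Theorems.PeaWorstToAvg.Negative.NotPeaWorstToAvgImpliesTarget
import Summits.PneNP.PneNP.Theorems.PeaWorstToAvg.Negative.PeaWorstToAvgWeakForm

/-!
# Line `dual-mode-compile` — skeleton for crux `SzkEntropy.PeaWorstToAvg` (stmt-PneNP-10777), generation 2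

Crux (route `PneNP/SzkEntropy`, decl `Summit.PneNP.PneNP.Theses.SzkEntropy.PeaWorstToAvg`; named form
`Theorems.szkEntropy_peaWorstToAvg_iff`): `A → C` with `A := PEA 3 ∉ PromiseBPP'` and
`C := ∃ D, D.IsPolySamplable ∧ (∀ n, supp Dₙ ⊆ (PEA 3).yes ∪ (PEA 3).no) ∧ ((PEA 3).yes, D) ∉ HeurBPP`.

Idea card `Cruxes/PeaWorstToAvg/Ideas/dual-mode-compile.md` (crux-ideate r1, ideator 1; triage r1: k1 pass ·
k2 FAIL (costume/socket) · k3-g2 pass-with-doubt; merge advice: ride with `lossy-mode-compilation`, keep the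
residual "hidden modes from worst-case hardness").  This is the generation-2 crux plan, published as an ADDENDUM
(`Lines/dual-mode-compile-gen2.lean` + `.md`) to the generation-1 skeleton `Lines/dual-mode-compile.lean`
(planner-cruxplan-stmt-PneNP-10777-dual-mode-compile-0, 2026-08-16T01:47Z; re-checked rc 0 this session): the line
was PICKED by the lead prover-line-stmt-PneNP-10777-0 at 01:59Z, whose reshaped 5-stub skeleton (sha 619a6474f5b4,
`stub_canon` split off `stub_compile`) is the REGISTERED one — this file is deliberately NOT passed through
`ledger skeleton check`, so that registration stands; the lead adopts it by transplanting the `ModeKit` object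
(see the card).  It keeps the generation-1 architecture — same four stub NAMES and signature TEXTS, same
composition shape — with three sharpenings:
(G2-1) the closing stub is stated in DOMINATION form (Levin / Bogdanov–Trevisan Def. 3.1 (ii)): the encoder's law
on an instance of mode `b` need only be dominated, up to an additive constant `slack < 1/2`, by a POLYNOMIAL
multiple `dom(|x|)` of the certified law of mode `b` — the generation-1 statement (total-variation closeness `1/16`)
is the case `dom = 1`, `slack = 1/16`; poly-size menus of target laws / side indices (triage r1-2 "poly(s) orbits +
side index") and success-`2/3` randomized Karp reductions into certified pairs are absorbed natively, so the stub is
now the WEAKEST kit the unchanged composition tolerates (the lead's stated hunt, `PICKED.md`);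
(G2-2) no `… : Prop` abbreviations (the arrow form `conclusion_of_parts` spells its four hypotheses); (G2-3) the
LANDED Negative lemmas of the crux are imported and answered (`Strengthenings`, `NotPeaWorstToAvgImpliesTarget`,
`WeakForm` imported; `AdviceAsymmetry` — landed 2026-08-16T01:35Z — is cited but not imported because the farm
snapshot had not built it at publication time; §3 `ModeKit.mix_charges_both`, §5 `noAdviceScheme_of_line`).

The card's LEVER — an indistinguishable, promise-separated, samplable pair `K₀ ⊆ NO`, `K₁ ⊆ YES` makes the fair
mixture `HeurBPP`-hard — is a tree THEOREM (`Theorems.not_mem_HeurBPP_of_isCompIndistinguishable`,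
`…_of_io_indistinguishable`, `conclusion_of_dualMode`, `Ensemble.isPolySamplable_mixEnsemble`), so it is NOT a stub.
The card's own transfer "`A` ⇒ some certified dual-mode pair is (i.o.-)indistinguishable" is the crux with a
strengthened conclusion (triage r1-2: costume) and is NOT a stub either.  The line files the STRUCTURAL statement
behind "hidden modes", of the worst-case kind the triage accepts (cf. `orbit-pair-rsr`'s C⁺ and
`lossy-mode-compilation`'s R1): a RANDOMIZED WORST-CASE-TO-AVERAGE-CASE REDUCTION of `PEA 3` onto a CERTIFIED
dual-mode pair — Dvir–Gutfreund–Rothblum–Vadhan's named open item "a worst-case/average-case reduction for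
`PEA`" (ECCC TR10-160 p. 3), with the one twist that makes the crux's strict support clause satisfiable: the
target ensembles are certified BY THEIR SAMPLERS.

* STUB 1 `stub_modeEncoding` (closing residual, research-level, HARDEST): a `ModeKit` exists — two UNIFORM
  polynomial-time samplers `samp false`, `samp true` (honest polynomial coin budget) supported, at every parameter
  and for every coin, on the NO resp. YES instances of `BPEA` (entropy approximation for affine parity branching
  programs, §1 — the format of every logspace keyed family), ONE uniform polynomial-time randomized map `enc` on
  instance strings, a polynomial `dom` and a constant `slack < 1/2`, such that for every YES (resp. NO) instance `x`
  of `PEA 3` and every event `E`:  `Pr[enc x ∈ E] ≤ dom(|x|) · Pr[samp true (1^{|x|}) ∈ E] + slack` (resp.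
  `samp false`).  Informally: a Levin-dominated randomized reduction from the worst case of `PEA₃` to the planted
  distributional problem `(BPEA, ½K₀ + ½K₁)`, stated with exactly the slack the decider tolerates; for `dom = 1`,
  `slack = 1/16` it is the generation-1 statement, a statistical randomized encoding of `PEA₃` with certified
  `⊕`-BP simulators (`PEA₃ ∈ SRE`, Applebaum–Raykov 2016).  It is implied by `orbit-pair-rsr.stub_transfer` +
  `stub_orbitKit` (a success-`2/3` randomized Karp reduction into one certified orbit pair, then entropy-EXACT
  orbit re-randomisation: `slack = 1/3 + 1/16`, `dom = 1` after size normalisation; poly(s) orbit pairs: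
  `dom = poly(s)`) and, trivially, by `¬A`; it allows what no
  entropy-exact move can use: entropy-CHANGING encoders, target laws spread over many entropy classes, targets in
  ANY `⊕L`-presented keyed family (number-theoretic, lattice, Goldreich/DUE-type local functions) — STUB 2 brings
  them all back into `PEA 3`.
* STUB 2 `stub_compile` (L–XL, PROVABLE, the card's name): `BPEA ≤ₚ PEA 3` — the Ishai–Kushilevitz / AIK PERFECT
  degree-3 randomizing polynomials of an affine parity branching program (`R₁ · L(x) · R₂`, canonical form
  depending on `det L(x)` only) and the exact entropy shift `H(p̂(U)) = H(F(U)) + |randomness|` (DGRV Thm. 4.5/4.6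
  in the general branching-program case; the tree's `RandomizingPolynomials*.lean` / `PEA_polyTimeReducible_PEA_three`
  do the PATH-program case).  Also the ingredient named missing in `lattice-import-trapdoor-support.stub_certBDD_karp_to_pea`.
* STUB 3 `stub_adviceElim` (L, PROVABLE; statement IDENTICAL to `orbit-pair-rsr.stub_adviceElim`, one proof serves
  both lines): a `HeurBPP` scheme — whose `RandAlg` coin budget is `O(log)` advice (Disproof §5; landed Negative
  lemma `Theorems.mem_HeurBPP_sizeClass`: EVERY size-class language is `HeurBPP`-easy on EVERY ensemble) — for a
  LABELLED mixture of two uniformly samplable certified components yields a UNIFORM scheme (`UHeurBPP`), by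
  labelled self-testing of the polynomially many candidate budgets.
* STUB 4 `stub_decider` (M–L, PROVABLE): a uniform scheme for `(BPEA.yes, ½K₀ + ½K₁)` plus a `ModeKit` decides
  `PEA 3` in `PromiseBPP'`: with `g := 1/2 − slack`, encode the input with `enc`, run the scheme (coin-amplified to
  error `≤ g/3`) at parameter `|x|` with failure parameter `m' = c·(dom(|x|) + 1)`, `c ≥ 6/g`, and take a majority
  over `O(1/g²)` independent repetitions (per run: bad-set mass `≤ 2/m'` under `K_b`, times `dom`, `+ slack`:
  correct with probability `≥ 1/2 + 7g/18`).

COMPOSITION `PeaWorstToAvg_of` (kernel-checked, no `sorry` outside the stubs; the ONLY theorem of the file whose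
conclusion is the crux decl): from `A` and the kit of STUB 1, the mixture of the two certified laws is samplable
(`Ensemble.isPolySamplable_mixEnsemble`) and on the promise of `BPEA`; were it `HeurBPP`-easy it would be
`UHeurBPP`-easy (STUB 3) and STUB 4 would put `PEA 3` in `PromiseBPP'`, contradicting `A`; so
`(BPEA.yes, mix) ∉ HeurBPP`, and STUB 2 with the landed push-forward
`Theorems.exists_hard_samplable_pea_of_polyTimeReducible` (p71914) concludes the crux BY NAME.  §5 records the
SOCKET role of the line (sorry-free modulo STUB 2): ANY computationally (or i.o.-) indistinguishable certified pair
of `BPEA` ensembles — QR / DDH / DCR / decision-LWE modes (the `lossy-mode-compilation` merge and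
`lattice-import-trapdoor-support`'s trapdoor-certified modes), orbit pairs, planted local functions — closes the
crux outright, together with its hypothesis.

DISPROOF.LEAN (gen 2, cycle 2, 2026-08-16) HONOURED: it has NO `_false_without_<H>` theorem and `-- Targets: none
yet`, so nothing is to be honoured by name; §1 (`not_peaWorstToAvg_iff`): the hypothesis `A` is USED, in the
composition, through STUB 4; §4 (`not_forall_ensembles`, `mem_HeurBPP_of_support_subset_no/_yes`,
`exists_yes_and_no_of_hard`; landed as `Negative/PeaWorstToAvgStrengthenings.lean`): the hard ensemble is the ½/½
mixture of two CERTIFIED opposite-mode samplers — planted and two-sided by construction (`ModeKit.mix_charges_both`),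
never a re-randomisation of one map; §5 (advice asymmetry, `not_peaWorstToAvg_of_promiseScheme`; landed as
`Negative/PeaWorstToAvgAdviceAsymmetry.lean`, `mem_HeurBPP_sizeClass`, `szkEntropy_not_peaWorstToAvg_of_promiseScheme`):
budgeted explicitly as STUB 3 — the line DELIVERS hardness against `coinLen`-advice schemes, which is what the
Negative file says a proof must deliver, and keeps the worst-case side uniform (`PromiseBPP'`, §3(b) `detHyp_iff`);
§5b / `Negative/PeaWorstToAvgWeakForm.lean` (`szkEntropy_peaWorstToAvg_imp_noAdviceScheme`: any proof of the typed
crux proves advice elimination for `PEA₃`): located, in this line, in STUB 1 (the certified targets are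
LABEL-samplable) + STUB 3 (labelled self-testing) — the classical reason random-self-reducible problems shed
`O(log)` advice — and recorded as the sorry-free corollary `noAdviceScheme_of_line` (§5);
§2 / `Negative/NotPeaWorstToAvgImpliesTarget.lean` (¬crux ⇒ thesis and summit): nothing to honour, no stub argues
from ¬crux; §6 / `BarrierNotesIdeator2` B1–B2 (GL re-randomisation, direct sums/products and AIK re-encodings of
ONE map are entropy-exact or leak the input subspace): STUB 1 asks for an encoder that is NOT entropy-exact and
whose target law is free up to polynomial domination — those dead candidates are excluded by name in the line
card, not re-proposed.  `ledger negatives --problem PneNP` (5 items per triage r1-1 and r1-3, none on PEA or branching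
programs); the BavardGap lesson (support conditions must be satisfiable at EVERY parameter) is met: `BPEA` has
fixed YES and NO instances (`exists_mem_BPEA_yes/no`, §3).

Layout: §1 objects (definitions only — to be landed verbatim by the lead as a Theorems defs file so that stub
proofs can state the registered signatures); §2 the four stubs (`sorry` only there); §3 sorry-free glue;
§4 the composition `PeaWorstToAvg_of`; §5 the socket theorems (reach of the line).

References: Dvir–Gutfreund–Rothblum–Vadhan, ECCC TR10-160 / ICS 2011, Thm. 1.1, Thm. 4.5–4.6, pp. 2–3
[DvirGutfreundRothblumVadhan2010]; Ishai–Kushilevitz, ICALP 2002, §3 [IshaiKushilevitz2002];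
Applebaum–Ishai–Kushilevitz, SICOMP 36 (2006), §4 [ApplebaumIshaiKushilevitz2006]; Applebaum–Raykov, CRYPTO 2016
Part III, pp. 449–477, Thm. 1 (`SRE ⊆ 1RE = NISZK^pub ⊆ SZK`), Thm. 3 (`SRE ⊄ BPP ⇒` i.o.-OWF) [ApplebaumRaykov2016];
Bogdanov–Trevisan, FnT-TCS 2006, Def. 2.1, 2.12–2.13, Def. 3.1 (ii) (domination), Lemma 3.2 [BogdanovTrevisan2006];
Levin 1986 and Impagliazzo–Levin 1990 (domination) [Levin1986; ImpagliazzoLevin1990]; Peikert–Waters, STOC 2008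
(lossy / dual-mode families) [PeikertWaters2008]; Goldreich 2001, Def. 3.2.2 [Goldreich2001]; Goldreich 2006,
Def. 1.2, 1.4 [Goldreich2006]; Feigenbaum–Fortnow 1993 (random self-reducibility) [FeigenbaumFortnow1993];
Bitansky–Degwekar–Vaikuntanathan 2021 (no black-box SZK hardness from OWF) [BitanskyDegwekarVaikuntanathan2021].
-/

noncomputable section

set_option linter.dupNamespace false

namespace Summit.PneNP.PneNP.Cruxes.PeaWorstToAvg.DualModeCompile

open Literature.Computability.Complexity Literature.Computability.MetaComplexity
open Literature.Computability.Cryptography (IsCompIndistinguishable IsPPT distAdvantage)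
open Literature.InformationTheory.Entropy (mapEntropy)
open _root_.Computability
open Summit.PneNP.PneNP.Theorems

/-! ## §1 Objects of the line -/

/-- An AFFINE LABEL over `ℓ` input bits: a constant bit and a list of variable indices; its value at
`x ∈ F₂^ℓ` is `c + Σ_{i ∈ S} xᵢ` (repetitions cancel in pairs).  Ordinary branching-program labels
`1`, `xᵢ`, `¬xᵢ = 1 + xᵢ` are the cases `|S| ≤ 1`. [IshaiKushilevitz2002, §3] -/
abbrev AffLabel (ℓ : ℕ) : Type := Bool × List (Fin ℓ)

namespace AffLabel

/-- Value of an affine label at an input. -/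
def eval {ℓ : ℕ} (a : AffLabel ℓ) (x : Fin ℓ → ZMod 2) : ZMod 2 :=
  (if a.1 then 1 else 0) + (a.2.map x).sum

end AffLabel

/-- An AFFINE PARITY BRANCHING PROGRAM on `ℓ` input bits (sparse presentation): nodes `0, …, N` with
`N = P.length`, source `0`, sink `N`; row `i` lists the labels of the edges `i → i+1, i → i+2, …`
(missing entries: label `0`, i.e. no edge).  Its value is the number modulo `2` of source-to-sink paths,
weighted by the product of the edge labels — every `⊕L` / deterministic-logspace keyed function has
polynomial-size such programs (one per output bit). [IshaiKushilevitz2002, §3; ApplebaumIshaiKushilevitz2006, §4] -/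
abbrev AffBP (ℓ : ℕ) : Type := List (List (AffLabel ℓ))

namespace AffBP

variable {ℓ : ℕ}

/-- The label of the edge from node `i` to node `j + 1` (meaningful for `i ≤ j`; default `0`). -/
def label (P : AffBP ℓ) (i j : ℕ) : AffLabel ℓ :=
  (P.getD i []).getD (j - i) (false, [])

/-- **The Ishai–Kushilevitz matrix** `L(x)` of the program at input `x`: rows = nodes `0 … N-1`,
columns = nodes `1 … N`; entry `(i, j)` = value of the label of the edge `i → j+1` for `i ≤ j`, `1` on the
subdiagonal (`i = j + 1`; `-1 = 1` over `F₂`), `0` below it.  [IshaiKushilevitz2002, §3 (the matrix `L(x)`)] -/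
def mat (P : AffBP ℓ) (x : Fin ℓ → ZMod 2) : Matrix (Fin P.length) (Fin P.length) (ZMod 2) :=
  Matrix.of fun i j =>
    if i.val ≤ j.val then (P.label i.val j.val).eval x else if i.val = j.val + 1 then 1 else 0

/-- **Value of the program** at `x`: `det L(x)` = the weighted number of source-to-sink paths mod `2`
(expansion of the unit-lower-Hessenberg determinant). [IshaiKushilevitz2002, §3] -/
def eval (P : AffBP ℓ) (x : Fin ℓ → ZMod 2) : ZMod 2 :=
  (P.mat x).det

end AffBP

/-- A multi-output affine parity branching program on `ℓ` input bits: one program per output bit. -/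
abbrev AffBPMap (ℓ : ℕ) : Type := List (AffBP ℓ)

namespace AffBPMap

variable {ℓ : ℕ}

/-- The output word at `x`. -/
def eval (F : AffBPMap ℓ) (x : Fin ℓ → ZMod 2) : List (ZMod 2) :=
  F.map fun P => P.eval x

/-- **Output entropy** `H(F(U_ℓ))` in bits of the map on a uniform input (`mapEntropy`, as for
`PolyMapF2.entropy`). [DvirGutfreundRothblumVadhan2010, Def. 2.1] -/
def entropy (F : AffBPMap ℓ) : ℝ :=
  mapEntropy Finset.univ F.eval

/-- Boolean encoding of multi-output affine programs on `ℓ` inputs (labels: bit paired with a list of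
variable indices in binary; nested self-delimiting lists — the combinators of `PEAInst.encoding`). -/
def encoding (ℓ : ℕ) : Encoding (AffBPMap ℓ) Bool :=
  ((encodingBoolBool.pairBool (encodingFinBool ℓ).listBool).listBool.listBool).listBool

end AffBPMap

/-- Instances of `BPEA`: number of input bits `ℓ`, a multi-output affine parity branching program on
`ℓ` bits, an integer entropy threshold `k`. -/
abbrev BPEAInst : Type := Σ ℓ : ℕ, AffBPMap ℓ × ℕ

/-- Boolean encoding of `BPEA` instances: `ℓ` in binary, then the program paired with `k` in binary. -/
def BPEAInst.encoding : Encoding BPEAInst Bool :=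
  Encoding.sigmaBool fun ℓ => (AffBPMap.encoding ℓ).pairBool encodingNatBool

/-- **`BPEA` — Branching-Program Entropy Approximation** (gap `1` at integer thresholds, the convention of
`PEA`): on `(F, k)` with `F` a multi-output affine parity branching program, YES iff `H(F(U_ℓ)) ≥ k + 1`,
NO iff `H(F(U_ℓ)) ≤ k`.  This is Entropy Approximation [GoldreichSahaiVadhan1999] for `⊕`-branching-program
samplers — the format in which EVERY logspace keyed family (QR, DDH, DCR, LWE modes; Goldreich/DUE local
functions; affine orbits of cubic maps) presents its two modes, and the SOURCE of the AIK compile `BPEA ≤ₚ PEA 3`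
(`stub_compile`). [DvirGutfreundRothblumVadhan2010, Thm. 4.5–4.6; ApplebaumIshaiKushilevitz2006, §4] -/
def BPEA : PromiseProblem :=
  PromiseProblem.ofEncoding BPEAInst.encoding
    {I | (I.2.2 : ℝ) + 1 ≤ AffBPMap.entropy I.2.1}
    {I | AffBPMap.entropy I.2.1 ≤ (I.2.2 : ℝ)}

/-- `UHeurBPP`: randomized heuristic schemes (Bogdanov–Trevisan Def. 2.12–2.13, the tree's `HeurBPP`) whose
coin budget is an honest polynomial of the input length — the UNIFORM sub-class.  The tree's `RandAlg.coinLen`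
is an arbitrary polynomially bounded function, i.e. `O(log)` advice: by the landed Negative lemma
`Theorems.mem_HeurBPP_sizeClass` every size-class language `{x | a (size |x|)}` (any `a : ℕ → Bool`) is in
`HeurBPP` on every ensemble, so `HeurBPP`-hardness — the crux's conclusion — is hardness against advice-taking
schemes; `UHeurBPP` is where a uniform worst-case decider can come from (STUB 4), and STUB 3 bridges the two.
Verbatim the notion of `Lines/orbit-pair-rsr.lean`. [BogdanovTrevisan2006, Def. 2.12–2.13; AroraBarak2009, §6.3] -/
def UHeurBPP : Set DistProblem :=
  {Q | ∃ A : RandAlg (List Bool × ℕ × ℕ) Bool, A.IsPolyTime schemeEnc encodeBool ∧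
    (∃ c : Polynomial ℕ, ∀ ℓ, A.coinLen ℓ = c.eval ℓ) ∧
    ∀ n m : ℕ, 0 < m →
      Q.dist.prob n {x | 1 / 4 ≤ A.pr schemeEnc (x, n, m) {b | b ≠ Q.lang.boolIndicator x}} ≤ 1 / m}

/-- **Mode kit** — the object asserted by the closing stub (generation 2: DOMINATION form).  A CERTIFIED
DUAL-MODE PAIR of branching-program samplers plus a DOMINATED RANDOMIZED REDUCTION of `PEA 3` onto it:
* `samp b` (`b = false/true`): UNIFORM polynomial-time samplers (honest polynomial coin budget `sampCoins`)
  whose output on `1ⁿ` is, for EVERY coin outcome and every `n`, a NO (resp. YES) instance of `BPEA`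
  — the "lossy" and the "injective" mode, certified BY THE SAMPLER (syntactically / by trapdoor / by
  construction), never by inspecting the instance;
* `enc`: ONE uniform polynomial-time randomized map on strings (honest coin budget `encCoins`);
* `dom`, `slack`: a polynomial DOMINATION FACTOR and a constant SLACK `< 1/2` such that for every YES instance `x`
  of `PEA 3` and every event `E`, `Pr[enc x ∈ E] ≤ dom(|x|) · Pr[samp true (1^{|x|}) ∈ E] + slack`, and the same
  for NO instances with `samp false` (Levin / Bogdanov–Trevisan domination of the query law by the certified law
  of the RIGHT mode, up to an additive slack that absorbs off-law and off-promise outputs; `slack < 1/2` is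
  exactly what the decider of STUB 4 tolerates — the randomized-reduction threshold).
For `dom = 1` the condition is one-sided closeness on every event, i.e. total variation `≤ slack`, and `enc` is a
statistical randomized encoding of the promise problem `PEA 3` whose two simulators are the certified mode
samplers (the generation-1 statement, with `slack = 1/16`; Applebaum–Raykov's `SRE`); a uniform choice among
`q(|x|)` target laws per mode is ONE certified sampler with `dom = q`; a randomized Karp reduction with success
`≥ 2/3` into one certified orbit pair followed by orbit re-randomisation (`orbit-pair-rsr`) is a kit with
`slack = 1/3 + 1/16` (and `dom = 1` after size normalisation, `dom = poly` without).  `enc` need NOT preserve entropy and need NOT land on the promise for every coin.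
[BogdanovTrevisan2006, Def. 3.1 (ii); Levin1986; ImpagliazzoLevin1990; ApplebaumRaykov2016, Def. of `SRE`, Thm. 3;
PeikertWaters2008 (dual-mode families); FeigenbaumFortnow1993 (random self-reductions)] -/
structure ModeKit where
  /-- certified sampler of mode `b` on input `1ⁿ` -/
  samp : Bool → RandAlg ℕ (List Bool)
  samp_polyTime : ∀ b, (samp b).IsPolyTime unaryEncodeNat (id : List Bool → List Bool)
  /-- its coin budget is this polynomial of the input length (uniformity) -/
  sampCoins : Polynomial ℕ
  samp_coinLen : ∀ b ℓ, (samp b).coinLen ℓ = sampCoins.eval ℓ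
  samp_no : ∀ n, ∀ w ∈ ((samp false).outputPMF unaryEncodeNat n).support, w ∈ BPEA.no
  samp_yes : ∀ n, ∀ w ∈ ((samp true).outputPMF unaryEncodeNat n).support, w ∈ BPEA.yes
  /-- the randomized reduction on instance strings -/
  enc : RandAlg (List Bool) (List Bool)
  enc_polyTime : enc.IsPolyTime (id : List Bool → List Bool) (id : List Bool → List Bool)
  encCoins : Polynomial ℕ
  enc_coinLen : ∀ ℓ, enc.coinLen ℓ = encCoins.eval ℓ
  /-- the domination factor (a polynomial of the instance length) -/
  dom : Polynomial ℕ
  /-- the additive slack: any constant below `1/2` (the randomized-reduction threshold) -/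
  slack : ℝ
  slack_lt_half : slack < 1 / 2
  enc_yes : ∀ x ∈ (PEA 3).yes, ∀ E : Set (List Bool),
    enc.pr id x E ≤ ((dom.eval x.length : ℕ) : ℝ) * (samp true).pr unaryEncodeNat x.length E + slack
  enc_no : ∀ x ∈ (PEA 3).no, ∀ E : Set (List Bool),
    enc.pr id x E ≤ ((dom.eval x.length : ℕ) : ℝ) * (samp false).pr unaryEncodeNat x.length E + slack

namespace ModeKit

/-- The certified law of mode `b`: `n ↦` law of `samp b` on `1ⁿ`. -/
def law (kit : ModeKit) (b : Bool) : Ensemble := fun n => (kit.samp b).outputPMF unaryEncodeNat n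

/-- The hard ensemble of the line: the fair mixture of the two certified laws. -/
def mix (kit : ModeKit) : Ensemble := mixEnsemble (kit.law false) (kit.law true)

end ModeKit

/-! ## §2 The stubs (`sorry` lives only here) -/

/-- **STUB 1 · `stub_modeEncoding`** (closing residual; research-level, OPEN — HARDEST; the lead holds it).
`PEA 3` has a polynomially DOMINATED randomized reduction onto a certified dual-mode pair of branching-program
entropy instances (`ModeKit`): Dvir–Gutfreund–Rothblum–Vadhan's open item "a worst-case/average-case reduction
for `PEA`" (ECCC TR10-160 p. 3) with sampler-side certificates — "hidden modes" in unconditional form.  Why it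
might fail: with `A` it yields the crux's `C` and hence (Ostrovsky 1991) one-way functions from `SZKP_L`-hardness,
open since Ostrovsky–Wigderson 1993 (for `dom = 1` it even puts `SZKP_L` inside `SRE ⊆ SZK`, Applebaum–Raykov
Thm. 3); and `enc` must send all YES (resp. NO) instances of a length into the polynomial shadow of ONE law of the
right mode (up to the slack) WITHOUT computing entropies — by Disproof §6 / the landed orbit lemmas an entropy-EXACT move serves
only polynomially many entropy/orbit classes per length (GL/affine re-randomisation, direct sums/products, AIK
re-encoding of one map: barrier notes B1–B2), so `enc` must cross classes; no such instance-randomising gadget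
for cubic maps is known.  Implied by `orbit-pair-rsr.stub_transfer` + `stub_orbitKit` and by `¬A`; implies,
with STUBS 3–4 and `A`, the card's "hidden modes" (the mixture is hard, §4).
[DvirGutfreundRothblumVadhan2010, pp. 2–3; BogdanovTrevisan2006, Def. 3.1 (ii); ApplebaumRaykov2016, Thm. 3;
FeigenbaumFortnow1993] -/
theorem stub_modeEncoding : Nonempty ModeKit := by
  sorry

/-- **STUB 2 · `stub_compile`** (L–XL, PROVABLE — the AIK compile).  `BPEA ≤ₚ PEA 3`: on `⟨ℓ, (F, k)⟩` output
`⟨ℓ + s, (p̂, k + s)⟩` where, for each output program `P` of `F` with matrix `L_P(x)` (`AffBP.mat`), `p̂`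
lists the entries on and above the diagonal of `R₁ · L_P(x) · R₂` with `R₁` a generic upper unitriangular and
`R₂` a generic "last column" matrix in FRESH variables (`RandPoly.IsUnitri` / `IsLastCol`), `s` = number of
fresh variables: every entry is a sparse polynomial of degree `≤ 3` with `O(N²)` monomials; for every `x`
the randomization is a bijection between randomness and matrices of canonical form `C_{det L_P(x)}`
(Ishai–Kushilevitz canonical-form lemma for unit-lower-Hessenberg matrices — the tree proves the path-matrix
case, `RandomizingPolynomialsCanon.lean`), hence PERFECT: `H(p̂(U_{ℓ+s})) = H(F(U_ℓ)) + s` exactly, YES ↦ YES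
and NO ↦ NO at the shifted integer threshold; the instance map is one `FP` function on codes (as
`codeFP_reduceRaw` in `PEADegreeReduction.lean`). [IshaiKushilevitz2002, §3; ApplebaumIshaiKushilevitz2006,
§4.2; DvirGutfreundRothblumVadhan2010, Thm. 4.5–4.6; Goldreich2006, Def. 1.4] -/
theorem stub_compile : BPEA.PolyTimeReducible (PEA 3) := by
  sorry

/-- **STUB 3 · `stub_adviceElim`** (L, PROVABLE — advice elimination by labelled self-testing; statement
IDENTICAL to `orbit-pair-rsr.stub_adviceElim`, one proof serves both lines).  If the two components of a fair
mixture are sampled by UNIFORM samplers and lie inside the NO resp. YES side of a disjoint promise problem (so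
samples come LABELLED), every advice-taking heuristic scheme `A` for `(Q.yes, mixture)` yields a uniform one
`U(y, 1ⁿ, 1ᵐ)`: pad the failure parameter of EVERY query `y'` (the input and the test samples alike) to
`m'(y') = G(n, m) − 2|y'| − 2n − 4`, so that all padded queries have the same length `G(n, m)` and hence ONE
unknown budget `c* = coinLen_A(G) ≤ p_A(G)` (the device of the tree's `exists_padded_simulator`; bad mass
`Σ_j 1/m'_j ≤ 1/(64m)`); enumerate the candidates `c ≤ p_A(G)`, estimate each majority-amplified candidate's
labelled error on `N = O(m² log(m·p_A(G)))` fresh samples `(b, S_b(1ⁿ))` (Hoeffding), and run the first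
candidate with empirical error `≤ 3/(64m)` — the true budget passes, and by Markov any passing candidate has
bad-set mass `≤ 1/(2m)`; `U` reads an honest polynomial number of coins (a polynomial in the `schemeEnc`
length, which bounds `|y|`, `n`, `m` since both parameters are unary).  Consistent with the landed
`Theorems.mem_HeurBPP_sizeClass` (there the certified uniform samplers force the support into computable size
classes, where a uniform scheme exists). [BogdanovTrevisan2006, Def. 2.12–2.13 and Lemma 3.2; AroraBarak2009,
§6.3, Thm. 7.10] -/
theorem stub_adviceElim (Q : PromiseProblem) (hQ : Q.Disjoint) (S : Bool → RandAlg ℕ (List Bool))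
    (hS : ∀ b, (S b).IsPolyTime unaryEncodeNat (id : List Bool → List Bool))
    (c : Polynomial ℕ) (hc : ∀ b ℓ, (S b).coinLen ℓ = c.eval ℓ)
    (h₀ : ∀ n, ∀ w ∈ ((S false).outputPMF unaryEncodeNat n).support, w ∈ Q.no)
    (h₁ : ∀ n, ∀ w ∈ ((S true).outputPMF unaryEncodeNat n).support, w ∈ Q.yes)
    (h : (⟨Q.yes, mixEnsemble (fun n => (S false).outputPMF unaryEncodeNat n)
        (fun n => (S true).outputPMF unaryEncodeNat n)⟩ : DistProblem) ∈ HeurBPP) :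
    (⟨Q.yes, mixEnsemble (fun n => (S false).outputPMF unaryEncodeNat n)
        (fun n => (S true).outputPMF unaryEncodeNat n)⟩ : DistProblem) ∈ UHeurBPP := by
  sorry

/-- **STUB 4 · `stub_decider`** (M–L, PROVABLE — the dominated decider).  A uniform heuristic scheme `A` for
`(BPEA.yes, ½K₀ + ½K₁)` (the kit's certified laws) decides `PEA 3` in textbook `PromiseBPP'`.  Let
`g := 1/2 − slack > 0` and fix an integer `c ≥ 6/g` (a constant of the machine, like the kit).  On `x`, with
`m' := c · (dom(|x|) + 1)`, repeat `t = O(1/g²)` times independently — draw `y ← enc x`, run `A(y, 1^{|x|}, 1^{m'})`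
`O(log(1/g))` times on the SAME `y` with fresh coins (its polynomial, hence computable, coin budget) and keep the
majority answer `a(y)` — and output the majority of the `t` answers.  Per run, on a YES instance: the bad set of
`A` at `(|x|, m')` (coin error `≥ 1/4`) has mixture-mass `≤ 1/m'`, hence `K₁`-mass `≤ 2/m'`
(`toOuterMeasure_le_two_mul_mixEnsemble`); off-support strings have `K₁`-mass `0`; by `enc_yes` (domination)
the draw `y` avoids both except with probability `≤ dom(|x|) · 2/m' + slack ≤ g/3 + slack = 1/2 − 2g/3`, and
then `y ∈ supp K₁ ⊆ BPEA.yes` (certificate `samp_yes`) so `a(y) = true` with probability `≥ 1 − g/3`: the run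
is correct with probability `≥ (1/2 + 2g/3)(1 − g/3) ≥ 1/2 + 7g/18`; Hoeffding over the `t` runs gives `≥ 2/3`;
symmetrically on NO instances (`BPEA` is disjoint, `BPEA_disjoint`).  (`dom(|x|) ≥ 1` wherever a promise
instance of length `|x|` exists, `ModeKit.one_le_dom_of_yes`.)  The coin string of the `PromiseBPP'` machine
is a fixed polynomial in `|x|` (bounding `t ·` (`encCoins(|x|)` `+` the amplified scheme's budget at the
polynomial query length)), read by prefixes; the predicate `(x, coins) ↦ answer` is in `P`
(`mem_PromiseBPP'_of_fp_decider`).  Only the PPT test `y ↦ [A(y, 1^{|x|}, 1^{m'}) = true]` is applied to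
`enc x`, so a pseudo-domination variant of the kit (domination against PPT tests given `1^{|x|}`) would run the
same proof — recorded in the line card as the fallback weakening, not filed. [Goldreich2006, Def. 1.2;
AroraBarak2009, Def. 7.3, Thm. 7.10; BogdanovTrevisan2006, Def. 2.12 and Lemma 3.2 (domination factor in the
failure parameter)] -/
theorem stub_decider (kit : ModeKit) (h : (⟨BPEA.yes, kit.mix⟩ : DistProblem) ∈ UHeurBPP) :
    PEA 3 ∈ PromiseBPP' := by
  sorry

/-! ## §3 Glue (sorry-free) -/

/-- `BPEA` is a disjoint promise problem (`k + 1 ≤ H` and `H ≤ k` are incompatible; encodings are injective). -/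
theorem BPEA_disjoint : BPEA.Disjoint := by
  refine PromiseProblem.disjoint_ofEncoding _ (Set.disjoint_left.2 fun I hY hN => ?_)
  simp only [Set.mem_setOf_eq] at hY hN
  linarith

/-- Uniform schemes are schemes: `UHeurBPP ⊆ HeurBPP` (the converse fails by `Theorems.mem_HeurBPP_sizeClass` /
`Theorems.not_countable_heurBPP_uniformEnsemble`: `HeurBPP` is uncountable on the uniform ensemble). -/
theorem UHeurBPP_subset_HeurBPP : UHeurBPP ⊆ HeurBPP := by
  rintro Q ⟨A, hA, -, hbad⟩
  exact ⟨A, hA, hbad⟩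

/-- The empty program list on `0` inputs with threshold `0` is a NO instance of `BPEA` (`H = 0 ≤ 0`):
the NO side is inhabited at every parameter (cf. the BavardGap negative: support conditions must be
satisfiable at every `n`). -/
theorem exists_mem_BPEA_no : BPEAInst.encoding.encode ⟨0, ([], 0)⟩ ∈ BPEA.no := by
  refine (BPEAInst.encoding.mem_toLanguage_iff _ _).2 ?_
  show AffBPMap.entropy ([] : AffBPMap 0) ≤ ((0 : ℕ) : ℝ)
  have h : AffBPMap.eval ([] : AffBPMap 0) = fun _ => [] := by
    funext x
    simp [AffBPMap.eval]
  rw [AffBPMap.entropy, h, Literature.InformationTheory.Entropy.mapEntropy_const]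
  simp

/-- The one-edge program `x₀` on `1` input with threshold `0` is a YES instance of `BPEA` (`H = 1 ≥ 0 + 1`):
the YES side is inhabited too. -/
theorem exists_mem_BPEA_yes :
    BPEAInst.encoding.encode ⟨1, ([[[((false, [0]) : AffLabel 1)]]], 0)⟩ ∈ BPEA.yes := by
  refine (BPEAInst.encoding.mem_toLanguage_iff _ _).2 ?_
  show ((0 : ℕ) : ℝ) + 1 ≤ AffBPMap.entropy ([[[((false, [0]) : AffLabel 1)]]] : AffBPMap 1)
  have hev : AffBPMap.eval ([[[((false, [0]) : AffLabel 1)]]] : AffBPMap 1) = fun x => [x 0] := by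
    funext x
    simp [AffBPMap.eval, AffBP.eval, AffBP.mat, AffBP.label, AffLabel.eval, Matrix.det_unique]
  have hinj : Function.Injective (AffBPMap.eval ([[[((false, [0]) : AffLabel 1)]]] : AffBPMap 1)) := by
    rw [hev]
    intro x y hxy
    funext i
    fin_cases i
    simpa using hxy
  have hH := Literature.InformationTheory.Entropy.mapEntropy_of_injective
    (Finset.univ : Finset (Fin 1 → ZMod 2)) hinj
  rw [AffBPMap.entropy, hH]
  simp

/-- **Domination is the right generality (sanity check of (G2-1))**: one-sided closeness on every event up to
`s` — the generation-1 condition has `s = 1/16` — is domination with factor `1` and slack `s`.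
[BogdanovTrevisan2006, Def. 3.1 (ii)] -/
theorem close_imp_dominated {P K : Set (List Bool) → ℝ} {s : ℝ} (h : ∀ E, P E ≤ K E + s) (E : Set (List Bool)) :
    P E ≤ ((1 : ℕ) : ℝ) * K E + s := by
  simpa using h E

namespace ModeKit

variable (kit : ModeKit)

/-- The certified laws are polynomial-time samplable (by their very samplers). -/
theorem isPolySamplable_law (b : Bool) : (kit.law b).IsPolySamplable :=
  ⟨kit.samp b, kit.samp_polyTime b, fun _ => rfl⟩

/-- The mixture is polynomial-time samplable (tree: `Ensemble.isPolySamplable_mixEnsemble`, p70907). -/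
theorem isPolySamplable_mix : kit.mix.IsPolySamplable :=
  Ensemble.isPolySamplable_mixEnsemble (kit.isPolySamplable_law false) (kit.isPolySamplable_law true)

/-- The certified law of mode `false` lives on NO instances of `BPEA`. -/
theorem law_false_support (n : ℕ) (w : List Bool) (hw : w ∈ (kit.law false n).support) : w ∈ BPEA.no :=
  kit.samp_no n w hw

/-- The certified law of mode `true` lives on YES instances of `BPEA`. -/
theorem law_true_support (n : ℕ) (w : List Bool) (hw : w ∈ (kit.law true n).support) : w ∈ BPEA.yes :=
  kit.samp_yes n w hw

/-- The mixture is supported on the promise of `BPEA` (tree: `mixEnsemble_support_subset_promise`). -/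
theorem mix_support (n : ℕ) (w : List Bool) (hw : w ∈ (kit.mix n).support) :
    w ∈ BPEA.yes ∨ w ∈ BPEA.no :=
  mixEnsemble_support_subset_promise kit.law_false_support kit.law_true_support n w hw

/-- **Consistency with the landed Negative lemma** `Theorems.pea_exists_yes_and_no_of_not_mem_HeurBPP`
(`Theorems/PeaWorstToAvg/Negative/PeaWorstToAvgStrengthenings.lean`: a hard on-promise ensemble must charge
BOTH sides; one-sided ensembles are easy): the kit's mixture charges a YES and a NO instance of `BPEA` at EVERY
parameter, by construction (each certified law has non-empty support). -/
theorem mix_charges_both (n : ℕ) :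
    (∃ w ∈ (kit.mix n).support, w ∈ BPEA.yes) ∧ (∃ w ∈ (kit.mix n).support, w ∈ BPEA.no) := by
  obtain ⟨w₁, hw₁⟩ := (kit.law true n).support_nonempty
  obtain ⟨w₀, hw₀⟩ := (kit.law false n).support_nonempty
  exact ⟨⟨w₁, (mem_support_mixEnsemble_iff _ _ n w₁).2 (Or.inr hw₁), kit.law_true_support n w₁ hw₁⟩,
    ⟨w₀, (mem_support_mixEnsemble_iff _ _ n w₀).2 (Or.inl hw₀), kit.law_false_support n w₀ hw₀⟩⟩

/-- Each certified law is dominated by twice the mixture (tree: `toOuterMeasure_le_two_mul_mixEnsemble`) — the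
factor `2` in STUB 4's failure parameter. -/
theorem law_le_two_mul_mix (b : Bool) (n : ℕ) (E : Set (List Bool)) :
    (kit.law b n).toOuterMeasure E ≤ 2 * (kit.mix n).toOuterMeasure E := by
  have h := toOuterMeasure_le_two_mul_mixEnsemble (kit.law false) (kit.law true) n E b
  cases b <;> simpa [ModeKit.mix] using h

/-- The slack alone bounds nothing: at a YES instance the domination inequality with the FULL event forces
`dom(|x|) ≥ 1 − slack > 1/2`. [BogdanovTrevisan2006, Def. 3.1 (ii)] -/
theorem dom_ge_of_yes (x : List Bool) (hx : x ∈ (PEA 3).yes) :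
    1 - kit.slack ≤ ((kit.dom.eval x.length : ℕ) : ℝ) := by
  have h := kit.enc_yes x hx Set.univ
  have h1 : kit.enc.pr id x Set.univ = 1 := by
    rw [RandAlg.pr, (PMF.toOuterMeasure_apply_eq_one_iff _ _).2 (Set.subset_univ _)]
    simp
  have h2 : (kit.samp true).pr unaryEncodeNat x.length Set.univ = 1 := by
    rw [RandAlg.pr, (PMF.toOuterMeasure_apply_eq_one_iff _ _).2 (Set.subset_univ _)]
    simp
  rw [h1, h2] at h
  linarith

/-- Hence the (natural-number) domination factor is at least `1` at every length carrying a YES instance — STUB 4's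
failure parameter `c · (dom + 1)` never multiplies a vanishing factor where it matters. [BogdanovTrevisan2006, Def. 3.1 (ii)] -/
theorem one_le_dom_of_yes (x : List Bool) (hx : x ∈ (PEA 3).yes) : 1 ≤ kit.dom.eval x.length := by
  have h := kit.dom_ge_of_yes x hx
  have hs := kit.slack_lt_half
  have hpos : (0 : ℝ) < ((kit.dom.eval x.length : ℕ) : ℝ) := by linarith
  exact Nat.one_le_iff_ne_zero.2 (Nat.pos_iff_ne_zero.1 (by exact_mod_cast hpos))

end ModeKit

/-! ## §4 Composition -/

/-- **The line on `BPEA`.** From a kit (STUB 1), STUB 3 and STUB 4 (as statements) and the crux's hypothesis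
`A : PEA 3 ∉ PromiseBPP'`: the mixture of the kit's certified laws is a polynomial-time samplable ensemble on
the promise of `BPEA` on which `BPEA.yes` is `HeurBPP`-hard — else advice elimination and the dominated decider
put `PEA 3` in `PromiseBPP'`. [BogdanovTrevisan2006, Def. 2.12–2.13, Def. 3.1; DvirGutfreundRothblumVadhan2010, pp. 2–3] -/
theorem bpea_hard_of_kit (kit : ModeKit)
    (hA : ∀ (Q : PromiseProblem), Q.Disjoint → ∀ (S : Bool → RandAlg ℕ (List Bool)),
      (∀ b, (S b).IsPolyTime unaryEncodeNat (id : List Bool → List Bool)) →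
      ∀ c : Polynomial ℕ, (∀ b ℓ, (S b).coinLen ℓ = c.eval ℓ) →
      (∀ n, ∀ w ∈ ((S false).outputPMF unaryEncodeNat n).support, w ∈ Q.no) →
      (∀ n, ∀ w ∈ ((S true).outputPMF unaryEncodeNat n).support, w ∈ Q.yes) →
      (⟨Q.yes, mixEnsemble (fun n => (S false).outputPMF unaryEncodeNat n)
          (fun n => (S true).outputPMF unaryEncodeNat n)⟩ : DistProblem) ∈ HeurBPP →
      (⟨Q.yes, mixEnsemble (fun n => (S false).outputPMF unaryEncodeNat n)
          (fun n => (S true).outputPMF unaryEncodeNat n)⟩ : DistProblem) ∈ UHeurBPP)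
    (hD : ∀ kit : ModeKit, (⟨BPEA.yes, kit.mix⟩ : DistProblem) ∈ UHeurBPP → PEA 3 ∈ PromiseBPP')
    (hPEA : PEA 3 ∉ PromiseBPP') :
    ∃ D : Ensemble, D.IsPolySamplable ∧ (∀ n : ℕ, ∀ w ∈ (D n).support, w ∈ BPEA.yes ∨ w ∈ BPEA.no) ∧
      (⟨BPEA.yes, D⟩ : DistProblem) ∉ HeurBPP := by
  refine ⟨kit.mix, kit.isPolySamplable_mix, kit.mix_support, fun hmem => hPEA (hD kit ?_)⟩
  exact hA BPEA BPEA_disjoint kit.samp kit.samp_polyTime kit.sampCoins kit.samp_coinLen kit.samp_no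
    kit.samp_yes hmem

/-- **The line, arrow form.** The four stub statements (spelled out) imply the unfolded crux: STUB 2
(`BPEA ≤ₚ PEA 3`) and the landed push-forward `Theorems.exists_hard_samplable_pea_of_polyTimeReducible`
(p71914) carry the hard samplable on-promise ensemble of `bpea_hard_of_kit` into `PEA 3`.
[DvirGutfreundRothblumVadhan2010, pp. 2–3 and Thm. 4.5; BogdanovTrevisan2006, Lemma 3.2] -/
theorem conclusion_of_parts (hE : Nonempty ModeKit) (hC : BPEA.PolyTimeReducible (PEA 3))
    (hA : ∀ (Q : PromiseProblem), Q.Disjoint → ∀ (S : Bool → RandAlg ℕ (List Bool)),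
      (∀ b, (S b).IsPolyTime unaryEncodeNat (id : List Bool → List Bool)) →
      ∀ c : Polynomial ℕ, (∀ b ℓ, (S b).coinLen ℓ = c.eval ℓ) →
      (∀ n, ∀ w ∈ ((S false).outputPMF unaryEncodeNat n).support, w ∈ Q.no) →
      (∀ n, ∀ w ∈ ((S true).outputPMF unaryEncodeNat n).support, w ∈ Q.yes) →
      (⟨Q.yes, mixEnsemble (fun n => (S false).outputPMF unaryEncodeNat n)
          (fun n => (S true).outputPMF unaryEncodeNat n)⟩ : DistProblem) ∈ HeurBPP →
      (⟨Q.yes, mixEnsemble (fun n => (S false).outputPMF unaryEncodeNat n)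
          (fun n => (S true).outputPMF unaryEncodeNat n)⟩ : DistProblem) ∈ UHeurBPP)
    (hD : ∀ kit : ModeKit, (⟨BPEA.yes, kit.mix⟩ : DistProblem) ∈ UHeurBPP → PEA 3 ∈ PromiseBPP') :
    PEA 3 ∉ PromiseBPP' → ∃ D : Ensemble, D.IsPolySamplable ∧
      (∀ n : ℕ, ∀ w ∈ (D n).support, w ∈ (PEA 3).yes ∨ w ∈ (PEA 3).no) ∧
      (⟨(PEA 3).yes, D⟩ : DistProblem) ∉ HeurBPP := by
  obtain ⟨kit⟩ := hE
  exact fun hPEA => exists_hard_samplable_pea_of_polyTimeReducible 3 hC (bpea_hard_of_kit kit hA hD hPEA)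

/-- **The skeleton concludes the crux BY NAME**: `Summit.PneNP.PneNP.Theses.SzkEntropy.PeaWorstToAvg` from the
four stubs (named form `Theorems.szkEntropy_peaWorstToAvg_iff`).  `sorry` lives only in the four `stub_*`; this is
the only theorem of the file whose conclusion is the crux decl. [DvirGutfreundRothblumVadhan2010, pp. 2–3] -/
theorem PeaWorstToAvg_of : Summit.PneNP.PneNP.Theses.SzkEntropy.PeaWorstToAvg :=
  szkEntropy_peaWorstToAvg_iff.2
    (conclusion_of_parts stub_modeEncoding stub_compile stub_adviceElim stub_decider)

/-! ## §5 The socket (reach of the line, sorry-free modulo STUB 2) -/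

/-- **Any indistinguishable certified pair of branching-program ensembles closes the crux outright** — and
proves its hypothesis `PEA 3 ∉ PromiseBPP'` (converse `szkEntropy_peaWorstToAvg_converse`).  This is the
card's SOCKET and the realised merge with `lossy-mode-compilation`: syntactically lossy/injective logspace
families under QR, DDH, DCR or decision-LWE (Peikert–Waters / FGKRS / MP12-trapdoor-certified modes, the latter
being `lattice-import-trapdoor-support`'s certified ensemble), the orbit laws of `orbit-pair-rsr`, planted local
functions — each is a pair `K₀ ⊆ BPEA.no`, `K₁ ⊆ BPEA.yes` of samplable ensembles, and STUB 2 compiles it into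
`PEA 3` (landed lever `not_mem_HeurBPP_of_isCompIndistinguishable`, p71078, + push-forward p71914).
[PeikertWaters2008; DvirGutfreundRothblumVadhan2010, pp. 2–3, Thm. 4.5; Goldreich2001, Def. 3.2.2] -/
theorem peaWorstToAvg_of_certifiedPair (hC : BPEA.PolyTimeReducible (PEA 3)) {K₀ K₁ : Ensemble}
    (hK₀ : K₀.IsPolySamplable) (hK₁ : K₁.IsPolySamplable)
    (h₀ : ∀ n : ℕ, ∀ w ∈ (K₀ n).support, w ∈ BPEA.no) (h₁ : ∀ n : ℕ, ∀ w ∈ (K₁ n).support, w ∈ BPEA.yes)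
    (hind : IsCompIndistinguishable K₀ K₁) :
    Summit.PneNP.PneNP.Theses.SzkEntropy.PeaWorstToAvg ∧ PEA 3 ∉ PromiseBPP' :=
  peaWorstToAvg_of_heurHard_reducible
    ⟨BPEA, hC, mixEnsemble K₀ K₁, Ensemble.isPolySamplable_mixEnsemble hK₀ hK₁,
      mixEnsemble_support_subset_promise h₀ h₁,
      not_mem_HeurBPP_of_isCompIndistinguishable BPEA_disjoint h₀ h₁
        (fun n E => by simpa using toOuterMeasure_le_two_mul_mixEnsemble K₀ K₁ n E false)
        (fun n E => by simpa using toOuterMeasure_le_two_mul_mixEnsemble K₀ K₁ n E true) hind⟩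

/-- **Infinitely-often form of the socket**: a samplable certified pair of `BPEA` ensembles that every PPT
distinguisher fails to `9/32`-distinguish at SOME parameter already closes the crux (landed
`not_mem_HeurBPP_of_io_indistinguishable`, p71453) — the quantifier shape worst-case hardness can deliver.
[DvirGutfreundRothblumVadhan2010, pp. 2–3; Goldreich2001, Def. 3.2.2] -/
theorem peaWorstToAvg_of_io_certifiedPair (hC : BPEA.PolyTimeReducible (PEA 3)) {K₀ K₁ : Ensemble}
    (hK₀ : K₀.IsPolySamplable) (hK₁ : K₁.IsPolySamplable)
    (h₀ : ∀ n : ℕ, ∀ w ∈ (K₀ n).support, w ∈ BPEA.no) (h₁ : ∀ n : ℕ, ∀ w ∈ (K₁ n).support, w ∈ BPEA.yes)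
    (hio : ∀ B : RandAlg (List Bool) Bool, IsPPT B encodeBool → ∃ n, distAdvantage B K₀ K₁ n < 9 / 32) :
    Summit.PneNP.PneNP.Theses.SzkEntropy.PeaWorstToAvg ∧ PEA 3 ∉ PromiseBPP' :=
  peaWorstToAvg_of_heurHard_reducible
    ⟨BPEA, hC, mixEnsemble K₀ K₁, Ensemble.isPolySamplable_mixEnsemble hK₀ hK₁,
      mixEnsemble_support_subset_promise h₀ h₁,
      not_mem_HeurBPP_of_io_indistinguishable BPEA_disjoint h₀ h₁
        (fun n E => by simpa using toOuterMeasure_le_two_mul_mixEnsemble K₀ K₁ n E false)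
        (fun n E => by simpa using toOuterMeasure_le_two_mul_mixEnsemble K₀ K₁ n E true) hio⟩

/-- **`PEA 3` itself sits in the socket**: cubic sparse maps ARE affine parity branching programs (a monomial
`x_i x_j x_k` is the path program `i → j → k`, a polynomial the parallel union of its monomials' paths), so a
certified pair of `PEA 3` ensembles is carried to `BPEA` along that embedding — recorded here only in the
degenerate direction the composition needs none of: with `K₀, K₁` already inside `PEA 3` the crux closes by the
landed `peaWorstToAvg_of_dualModePair` (no stub at all). [DvirGutfreundRothblumVadhan2010, Thm. 4.5] -/
theorem peaWorstToAvg_of_peaPair {K₀ K₁ : Ensemble}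
    (hK₀ : K₀.IsPolySamplable) (hK₁ : K₁.IsPolySamplable)
    (h₀ : ∀ n : ℕ, ∀ w ∈ (K₀ n).support, w ∈ (PEA 3).no) (h₁ : ∀ n : ℕ, ∀ w ∈ (K₁ n).support, w ∈ (PEA 3).yes)
    (hind : IsCompIndistinguishable K₀ K₁) :
    Summit.PneNP.PneNP.Theses.SzkEntropy.PeaWorstToAvg ∧ PEA 3 ∉ PromiseBPP' :=
  peaWorstToAvg_of_dualModePair ⟨K₀, K₁, hK₀, hK₁, h₀, h₁, hind⟩

/-- **The line sheds advice, as the landed Negative lemma `szkEntropy_peaWorstToAvg_imp_noAdviceScheme`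
(`Negative/PeaWorstToAvgWeakForm.lean`) says any proof of the typed crux must**: given the skeleton and the crux's
hypothesis, no tree scheme — `coinLen`-advice allowed — errs with probability `< 1/4` on every promise instance of
`PEA 3` at every `(n, m ≥ 2)`.  In this line that content sits in STUB 1 (label-samplable certified targets) and
STUB 3 (labelled self-testing); the corollary inherits the stubs' `sorry` through `PeaWorstToAvg_of` and is not a
stub itself. [AroraBarak2009, §6.3; BogdanovTrevisan2006, Def. 2.12–2.13; FeigenbaumFortnow1993] -/
theorem noAdviceScheme_of_line (hB : PEA 3 ∉ PromiseBPP') :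
    ¬ ∃ A : RandAlg (List Bool × ℕ × ℕ) Bool, A.IsPolyTime schemeEnc encodeBool ∧
      ∀ (n m : ℕ), 2 ≤ m → ∀ x : List Bool, (x ∈ (PEA 3).yes ∨ x ∈ (PEA 3).no) →
        A.pr schemeEnc (x, n, m) {b | b ≠ (PEA 3).yes.boolIndicator x} < 1 / 4 :=
  szkEntropy_peaWorstToAvg_imp_noAdviceScheme PeaWorstToAvg_of hB

end Summit.PneNP.PneNP.Cruxes.PeaWorstToAvg.DualModeCompile

end
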